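import Mathlib
import Summits.ResolutionOfSingularities.ResolutionOfSingularities.Theorems.WildQuotientsWildQuotientResolutionJordanThreeTwoChart0Fixed
import Summits.ResolutionOfSingularities.ResolutionOfSingularities.Theorems.WildQuotientsWildQuotientResolutionJordanFourHalfTransport
import Summits.ResolutionOfSingularities.ResolutionOfSingularities.Theorems.WildQuotientsWildQuotientResolutionJordanFourParity
import Summits.ResolutionOfSingularities.ResolutionOfSingularities.Theorems.WildQuotientsWildQuotientResolutionJordanFourConeVertexContraction
import Summits.ResolutionOfSingularities.ResolutionOfSingularities.Theorems.WildQuotientsWildQuotientResolutionJordanFourConeVertexIdeals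
import Summits.ResolutionOfSingularities.ResolutionOfSingularities.Theorems.WildQuotientsWildQuotientResolutionJordanFourChart0VertexIdeal
import Summits.ResolutionOfSingularities.ResolutionOfSingularities.Theorems.WildQuotientsWildQuotientResolutionSpanXComap

/-!
# N4a (`𝔸ⁿ/(J₃ ⊕ J₂)`, `p ≥ 3`), `μ₂`-vertex: the chart-`0` RING MODEL over the `½(1,1,1)` presentation

(crux stmt-ResolutionOfSingularities-15640 `WildQuotients.WildQuotientResolution`, line `Sketch`;
post-V5 width target N4a `JordanThreeTwo.jordanThreeTwo_hasResolution` (res-L1-w45c-plan-1 NO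
OBJECTION 2026-08-27T14:24:34Z), file R3 of res-L1-w45c-stub-2's plan 14:24:14Z; the J₃ ⊕ J₂ twin of
`JordanFive.exists_ringBrick_X0_model` (p537855) with res-L1-w45c-stub-4's `Half111` presentation
(p49xxxx, V4U) in place of `ToricChart.Ring … quarterDatum`. [OURS · L1 W4.5c] — NOT a statement of any
manuscript; replaces the role of no printed item. Def-free.)

SETTING. `k[x]` doubles as the root chart `U₀ = k[u, b, x_c, f, x_e, passengers]` of the `x_a`-vertex
chart `O_a = V[x_a]` of `Bl_I 𝔸ⁿ`, `I = ⟨x_a, x_b², x_bx_d, x_d²⟩` (slots `u = X a`, `b = X b`, `f = X d`);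
the chart ring is any `C` with `base : k[x] → C` and `eE : C ≃+* E` onto the weight-`0` part `E` of the
`μ₂`-weight `w₂ : (a,b,d) ↦ (1,1,1)` with `eE (base F) = ψ₀ F`, `ψ₀ : x_a ↦ u², x_b ↦ ub, x_d ↦ uf`;
`σ_U` is the abstract root-chart law (`…JordanThreeTwoRootChart`); the chart ratios are `t j`
(`x_a · t_j = c_j`, `c = (x_a, x_b², x_bx_d, x_d²)`, `j ≠ 0`).

RESULT `exists_ringBrick_X0_model` (`p` prime, `3 ≤ p = char k`): an INJECTIVE
`ψC : k[Y] ⧸ ker (Half111.presentation k n a b d) → C` onto the `σ_U`-fixed subring with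
`√(ψC⁻¹⟨base x_a, base x_b, base x_d, t_j⟩) =` the vertex ideal `⟨Half111.gens⟩` (radical:
`Half111.span_gens_isRadical`; `Bl` regular: `Half111.blowup_regular k n a b d` — NOT restated here).
ROUTE as p537855: `ψC := eE⁻¹ ∘ θ ∘ lift` (`θ : X b ↦ N, X c ↦ γ₂″, X e ↦ Z₁`), range by
`JordanThreeTwo.chart0_fixedPoints_eq_map` over `JordanFour.range_halfPresentation_eq_adjoin_evenGens` +
`mem_adjoin_evenGens_iff`; radical identity by `JordanFour.radical_span_eq_comap_of_isIntegral`, `θ⁻¹`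
(`SpanX.comap_span_X_eq_of_kill_comp` with `τ : X c ↦ 2X c`) and `Half111.comap_lift_span_X`.
-/

-- single-problem summit: the doubled namespace component `ResolutionOfSingularities` is forced
set_option linter.dupNamespace false

noncomputable section

open MvPolynomial

namespace Summit.ResolutionOfSingularities.ResolutionOfSingularities.Theorems.WildQuotientResolution.JordanThreeTwo

variable (k : Type) [Field k] (n : ℕ) (a b c d e : Fin n) (p : ℕ)

/-- The slot substitution datum: `X b ↦ N`, `X c ↦ γ₂″`, `X e ↦ Z₁`, other variables fixed. -/
local notation3 "g₃₂" => (fun i : Fin n => if i = b then X b ^ p - X a ^ (p - 1) * X b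
    else if i = c then 2 * X c - X b ^ 2 + X a * X b
    else if i = e then X e - X b * X d
    else (X i : MvPolynomial (Fin n) k))
/-- The root substitution `ψ₀` of the `μ₂`-vertex chart. -/
local notation3 "r₃₂" => (fun i : Fin n => if i = a then X a ^ 2 else if i = b then X a * X b
    else if i = d then X a * X d else (X i : MvPolynomial (Fin n) k))

variable (hab : a ≠ b) (hac : a ≠ c) (had : a ≠ d) (hae : a ≠ e) (hbc : b ≠ c) (hbd : b ≠ d)
  (hbe : b ≠ e) (hcd : c ≠ d) (hce : c ≠ e) (hde : d ≠ e)

/-! ## The slot substitution -/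

/-- `θ (x_b) = N`. [OURS · L1 W4.5c] -/
theorem slotSubst32_X_b :
    aeval g₃₂ (X b : MvPolynomial (Fin n) k) = X b ^ p - X a ^ (p - 1) * X b := by
  rw [aeval_X]; simp

include hbc in
/-- `θ (x_c) = γ₂″`. [OURS · L1 W4.5c] -/
theorem slotSubst32_X_c :
    aeval g₃₂ (X c : MvPolynomial (Fin n) k) = 2 * X c - X b ^ 2 + X a * X b := by
  rw [aeval_X]; simp [hbc.symm]

include hbe hce in
/-- `θ (x_e) = Z₁`. [OURS · L1 W4.5c] -/
theorem slotSubst32_X_e : aeval g₃₂ (X e : MvPolynomial (Fin n) k) = X e - X b * X d := by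
  rw [aeval_X]
  show (if e = b then _ else if e = c then _ else if e = e then _ else _) = _
  rw [if_neg hbe.symm, if_neg hce.symm, if_pos rfl]

/-- `θ (x_i) = x_i` for the other variables. [OURS · L1 W4.5c] -/
theorem slotSubst32_X_of_ne {i : Fin n} (h1 : i ≠ b) (h2 : i ≠ c) (h3 : i ≠ e) :
    aeval g₃₂ (X i : MvPolynomial (Fin n) k) = X i := by
  rw [aeval_X]; simp [h1, h2, h3]

include hab hac hae hbc hbe hcd hce hde in
/-- **`θ` is injective** (`3 ≤ p = char k`): `θ = ψ ∘ S_N` with `ψ` the slice automorphism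
(`rootChart32_subst_surjective`) and `S_N = JordanFour.substN k n a b p`. [OURS · L1 W4.5c] -/
theorem slotSubst32_injective (hp3 : 3 ≤ p) [CharP k p] :
    Function.Injective (aeval g₃₂ : MvPolynomial (Fin n) k →ₐ[k] MvPolynomial (Fin n) k) := by
  have h2 : (2 : k) ≠ 0 := by
    intro h
    have hdvd : p ∣ 2 := (CharP.cast_eq_zero_iff k p 2).mp (by exact_mod_cast h)
    have := Nat.le_of_dvd two_pos hdvd
    omega
  have hψa : aeval (fun i : Fin n => if i = c then 2 * X c - X b ^ 2 + X a * X b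
      else if i = e then X e - X b * X d else (X i : MvPolynomial (Fin n) k))
      (X a : MvPolynomial (Fin n) k) = X a := by rw [aeval_X]; simp [hac, hae]
  have hψb : aeval (fun i : Fin n => if i = c then 2 * X c - X b ^ 2 + X a * X b
      else if i = e then X e - X b * X d else (X i : MvPolynomial (Fin n) k))
      (X b : MvPolynomial (Fin n) k) = X b := by rw [aeval_X]; simp [hbc, hbe]
  have heq : (aeval g₃₂ : MvPolynomial (Fin n) k →ₐ[k] MvPolynomial (Fin n) k) =
      (aeval (fun i : Fin n => if i = c then 2 * X c - X b ^ 2 + X a * X b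
        else if i = e then X e - X b * X d else (X i : MvPolynomial (Fin n) k))).comp
        (JordanFour.substN k n a b p) := by
    refine MvPolynomial.algHom_ext fun i => ?_
    rw [AlgHom.comp_apply]
    by_cases hib : i = b
    · rw [hib, slotSubst32_X_b, JordanFour.substN_X_self, map_sub, map_mul, map_pow, map_pow, hψa,
        hψb]
    · rw [JordanFour.substN_X_of_ne k n a b p hib, aeval_X, aeval_X]
      simp [hib]
  rw [heq, AlgHom.coe_comp]
  refine Function.Injective.comp ?_ (JordanFour.substN_injective k n a b p hab (by omega))
  exact ToricExit.algHom_injective_of_surjective k n _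
    (rootChart32_subst_surjective k n a b c d e hac hae hbc hbe hcd hde h2 _ (by simp)
      (by simp [hce.symm]) (fun i hic hie => by simp [hic, hie]))

include hab hac hae hbc hbd hbe hcd hce hde in
/-- **`θ⁻¹ ⟨x_a, x_b, x_d⟩ = ⟨x_a, x_b, x_d⟩`** (`2 ∈ kˣ`): killing `x_a, x_b, x_d` after `θ` is `τ ∘ kill`
with `τ : X c ↦ 2X c` an automorphism. [OURS · L1 W4.5c] -/
theorem comap_slotSubst32_span_X (hp3 : 3 ≤ p) [CharP k p] :
    (Ideal.span (X '' ({a, b, d} : Set (Fin n)) : Set (MvPolynomial (Fin n) k))).comap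
      (aeval g₃₂ : MvPolynomial (Fin n) k →ₐ[k] MvPolynomial (Fin n) k) =
      Ideal.span (X '' ({a, b, d} : Set (Fin n))) := by
  classical
  have h2 : (2 : k) ≠ 0 := by
    intro h
    have hdvd : p ∣ 2 := (CharP.cast_eq_zero_iff k p 2).mp (by exact_mod_cast h)
    have := Nat.le_of_dvd two_pos hdvd
    omega
  have h2C : (2 : MvPolynomial (Fin n) k) * C (2⁻¹ : k) = 1 := JordanFour.two_mul_C_inv_two k n h2
  have hθa : aeval g₃₂ (X a : MvPolynomial (Fin n) k) = X a := slotSubst32_X_of_ne k n a b c d e p hab hac hae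
  have hθb := slotSubst32_X_b k n a b c d e p
  have hθc := slotSubst32_X_c k n a b c d e p hbc
  have hθd : aeval g₃₂ (X d : MvPolynomial (Fin n) k) = X d :=
    slotSubst32_X_of_ne k n a b c d e p hbd.symm hcd.symm hde
  have hθe := slotSubst32_X_e k n a b c d e p hbe hce
  let τ : MvPolynomial (Fin n) k →ₐ[k] MvPolynomial (Fin n) k :=
    aeval fun i => if i = c then 2 * X c else X i
  have hτC : ∀ r : k, τ (C r) = C r := fun r => τ.commutes r
  have hτc : τ (X c) = 2 * X c := by simp [τ]
  have hτi : ∀ i, i ≠ c → τ (X i) = X i := fun i hic => by simp [τ, hic]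
  have hτinj : Function.Injective τ := by
    refine ToricExit.algHom_injective_of_surjective k n τ
      (JordanFive.surjective_of_forall_X τ fun i => ?_)
    by_cases hic : i = c
    · refine ⟨C (2⁻¹ : k) * X c, ?_⟩
      rw [hic, map_mul, hτc, hτC]
      linear_combination (X c : MvPolynomial (Fin n) k) * h2C
    · exact ⟨X i, hτi i hic⟩
  set κ : MvPolynomial (Fin n) k →ₐ[k] MvPolynomial (Fin n) k :=
    aeval (fun i => if i ∈ ({a, b, d} : Set (Fin n)) then (0 : MvPolynomial (Fin n) k) else X i) with hκ
  have hκX : ∀ i, κ (X i) = if i ∈ ({a, b, d} : Set (Fin n)) then (0 : MvPolynomial (Fin n) k) else X i :=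
    fun i => by rw [hκ, aeval_X]
  have hκa : κ (X a) = 0 := by rw [hκX]; simp
  have hκb : κ (X b) = 0 := by rw [hκX]; simp
  have hκd : κ (X d) = 0 := by rw [hκX]; simp
  have hκc : κ (X c) = X c := by rw [hκX]; simp [hac.symm, hbc.symm, hcd]
  have hκe : κ (X e) = X e := by rw [hκX]; simp [hae.symm, hbe.symm, hde.symm]
  have hκi : ∀ i, i ≠ a → i ≠ b → i ≠ d → κ (X i) = X i := fun i h1 h2 h3 => by
    rw [hκX]; simp [h1, h2, h3]
  refine SpanX.comap_span_X_eq_of_kill_comp ({a, b, d} : Set (Fin n)) (aeval g₃₂) τ hτinj fun i => ?_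
  change κ (aeval g₃₂ (X i)) = τ (κ (X i))
  by_cases hia : i = a
  · rw [hia, hθa, hκa, map_zero]
  by_cases hib : i = b
  · rw [hib, hθb, map_sub, map_mul, map_pow, map_pow, hκa, hκb, map_zero, mul_zero, sub_zero,
      zero_pow (by omega : p ≠ 0)]
  by_cases hic : i = c
  · rw [hic, hθc, hκc, hτc]
    simp only [map_sub, map_add, map_mul, map_pow, map_ofNat, hκa, hκb, hκc]
    ring
  by_cases hid : i = d
  · rw [hid, hθd, hκd, map_zero]
  by_cases hie : i = e
  · rw [hie, hθe, hκe, hτi e hce.symm]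
    simp only [map_sub, map_mul, hκb, hκd, hκe]
    ring
  · rw [slotSubst32_X_of_ne k n a b c d e p hib hic hie, hκi i hia hib hid, hτi i hic]

/-! ## The ring model -/

include hab hac had hae hbc hbd hbe hcd hce hde in
-- one assembly over landed lemmas; the subalgebra coercions make some steps slow
set_option maxHeartbeats 800000 in
/-- **The chart-`0` (`μ₂`-vertex) ring model for `J₃ ⊕ J₂`** (see the module docstring): an injective
`ψC : k[Y] ⧸ ker (Half111.presentation k n a b d) → C` onto the `σ_U`-fixed subring with
`√(ψC⁻¹⟨base x_a, base x_b, base x_d, t⟩) = ⟨Half111.gens⟩`; `p` prime, `3 ≤ p = char k`.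
[OURS · L1 W4.5c] -/
theorem exists_ringBrick_X0_model (hp : p.Prime) (hp3 : 3 ≤ p) [CharP k p]
    (σU : MvPolynomial (Fin n) k ≃ₐ[k] MvPolynomial (Fin n) k)
    (hUb : σU (X b) = X b + X a) (hUc : σU (X c) = X c + X a * X b)
    (hUe : σU (X e) = X e + X a * X d) (hσU : ∀ i, i ≠ b → i ≠ c → i ≠ e → σU (X i) = X i)
    (w₂ : Fin n → ZMod 2) (hw₂a : w₂ a = 1) (hw₂b : w₂ b = 1) (hw₂d : w₂ d = 1)
    (hw₂0 : ∀ i, i ≠ a → i ≠ b → i ≠ d → w₂ i = 0)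
    (E : Subalgebra k (MvPolynomial (Fin n) k)) (hE : ∀ f, f ∈ E ↔ IsWeightedHomogeneous w₂ f 0)
    {C : Type} [CommRing C] (base : MvPolynomial (Fin n) k →+* C) (eE : C ≃+* ↥E)
    (hbase : ∀ F, ((eE (base F) : ↥E) : MvPolynomial (Fin n) k) = aeval r₃₂ F)
    (t : {j : Fin 4 // j ≠ 0} → C)
    (ht : ∀ j, base (X a) * t j =
      base ((![X a, X b ^ 2, X b * X d, X d ^ 2] : Fin 4 → MvPolynomial (Fin n) k) j.1)) :
    ∃ ψC : (MvPolynomial (Fin n ⊕ Fin 3) k ⧸ RingHom.ker (Half111.presentation k n a b d)) →+* C,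
      Function.Injective ψC ∧
      (∀ y, y ∈ ψC.range ↔ σU ((eE y : ↥E) : MvPolynomial (Fin n) k) = (eE y : MvPolynomial (Fin n) k)) ∧
      ((Ideal.span (base '' {X a, X b, X d} ∪ Set.range t)).comap ψC).radical =
        Ideal.span (Set.range (fun l : Fin 6 =>
          Ideal.Quotient.mk (RingHom.ker (Half111.presentation k n a b d)) (Half111.gens k n a b d l))) := by
  classical
  let S : Type := MvPolynomial (Fin n) k
  -- `p` is odd: the cone weight `w₁` of R2 is `w₂` itself
  have hp2 : (p : ZMod 2) = 1 := by
    obtain ⟨m, hm⟩ := hp.odd_of_ne_two (by omega)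
    rw [hm]; push_cast; rw [show (2 : ZMod 2) = 0 from rfl]; ring
  -- the presentation, its injective lift and the slot substitution
  set pres : MvPolynomial (Fin n ⊕ Fin 3) k →ₐ[k] S := Half111.presentation k n a b d with hpres
  let lift : (MvPolynomial (Fin n ⊕ Fin 3) k ⧸ RingHom.ker pres) →+* S :=
    Ideal.Quotient.lift (RingHom.ker pres) (pres : MvPolynomial (Fin n ⊕ Fin 3) k →+* S) fun _ h => h
  have hlift_inj : Function.Injective lift :=
    RingHom.lift_injective_of_ker_le_ideal _ (fun _ h => h) le_rfl
  have hlift_mk : ∀ y, lift (Ideal.Quotient.mk _ y) = pres y := fun y => rfl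
  let θ : S →ₐ[k] S := aeval g₃₂
  have hθinj : Function.Injective θ :=
    slotSubst32_injective k n a b c d e p hab hac hae hbc hbe hcd hce hde hp3
  let Φ : (MvPolynomial (Fin n ⊕ Fin 3) k ⧸ RingHom.ker pres) →+* S :=
    (θ : S →+* S).comp lift
  have hΦ : ∀ y, Φ y = θ (lift y) := fun y => rfl
  have hΦinj : Function.Injective Φ := hθinj.comp hlift_inj
  -- `R = range pres` is the weight-`0` part of `w₂`
  let R : Subalgebra k S := pres.range
  have hR : ∀ Q, Q ∈ R ↔ IsWeightedHomogeneous w₂ Q 0 := by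
    intro Q
    change Q ∈ pres.range ↔ _
    rw [hpres, JordanFour.range_halfPresentation_eq_adjoin_evenGens]
    exact JordanFour.mem_adjoin_evenGens_iff k n a b d hab had hbd w₂ hw₂a hw₂b hw₂d hw₂0 Q
  -- R2: the fixed ring of `σ_U` inside the weight-`0` part is `θ(R)`
  have hfix := chart0_fixedPoints_eq_map k n σU a b c d e hab hac hae hbc hbd hbe hcd hce hde
    hUb hUc hUe hσU p hp hp3 w₂ hw₂a hw₂b hw₂d hw₂0 w₂ hw₂a (hw₂b.trans hp2.symm) hw₂d hw₂0 R hR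
  have hΦmem : ∀ y, IsWeightedHomogeneous w₂ (Φ y) 0 ∧ σU (Φ y) = Φ y := by
    intro y
    obtain ⟨F, rfl⟩ := Ideal.Quotient.mk_surjective y
    have h : Φ (Ideal.Quotient.mk _ F) ∈ ((R.map θ : Subalgebra k S) : Set S) :=
      Subalgebra.mem_map.mpr ⟨pres F, ⟨F, rfl⟩, rfl⟩
    rw [← hfix] at h
    exact h
  -- `ψC := eE⁻¹ ∘ Φ`
  let ψ' : (MvPolynomial (Fin n ⊕ Fin 3) k ⧸ RingHom.ker pres) →+* ↥E :=
    Φ.codRestrict E fun y => (hE _).mpr (hΦmem y).1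
  have hψ'val : ∀ y, ((ψ' y : ↥E) : S) = Φ y := fun y => rfl
  let ψC : (MvPolynomial (Fin n ⊕ Fin 3) k ⧸ RingHom.ker pres) →+* C :=
    (eE.symm : ↥E →+* C).comp ψ'
  have hψC : ∀ y, eE (ψC y) = ψ' y := fun y => eE.apply_symm_apply _
  -- values of the structure map and of the ratios
  have hra : aeval r₃₂ (X a : S) = X a ^ 2 := by rw [aeval_X]; simp
  have hrb : aeval r₃₂ (X b : S) = X a * X b := by rw [aeval_X]; simp [hab.symm]
  have hrd : aeval r₃₂ (X d : S) = X a * X d := by rw [aeval_X]; simp [had.symm, hbd.symm]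
  have hbXa : ((eE (base (X a)) : ↥E) : S) = X a ^ 2 := by rw [hbase, hra]
  have hbXb : ((eE (base (X b)) : ↥E) : S) = X a * X b := by rw [hbase, hrb]
  have hbXd : ((eE (base (X d)) : ↥E) : S) = X a * X d := by rw [hbase, hrd]
  have hcancel : ∀ (tj : C) (F q : S), base (X a) * tj = base F → aeval r₃₂ F = X a ^ 2 * q →
      ((eE tj : ↥E) : S) = q := by
    intro tj F q h hF
    have h1 := congrArg (fun z => ((eE z : ↥E) : S)) h
    simp only [map_mul, Subalgebra.coe_mul, hbXa, hbase, hF] at h1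
    exact mul_left_cancel₀ (pow_ne_zero 2 (X_ne_zero a)) h1
  have hval1 : ((eE (t ⟨1, by decide⟩) : ↥E) : S) = X b ^ 2 :=
    hcancel _ (X b ^ 2) _ (ht ⟨1, by decide⟩) (by rw [map_pow, hrb]; ring)
  have hval2 : ((eE (t ⟨2, by decide⟩) : ↥E) : S) = X b * X d :=
    hcancel _ (X b * X d) _ (ht ⟨2, by decide⟩) (by rw [map_mul, hrb, hrd]; ring)
  have hval3 : ((eE (t ⟨3, by decide⟩) : ↥E) : S) = X d ^ 2 :=
    hcancel _ (X d ^ 2) _ (ht ⟨3, by decide⟩) (by rw [map_pow, hrd]; ring)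
  have hjcases : ∀ j : {j : Fin 4 // j ≠ 0}, j = ⟨1, by decide⟩ ∨ j = ⟨2, by decide⟩ ∨ j = ⟨3, by decide⟩ := by
    rintro ⟨j, hj⟩
    fin_cases j
    · exact absurd rfl hj
    · exact Or.inl rfl
    · exact Or.inr (Or.inl rfl)
    · exact Or.inr (Or.inr rfl)
  -- integrality and the prime `M = ⟨x_a, x_b, x_d⟩`
  haveI : Algebra.IsIntegral (↥E) S := by
    refine ⟨fun x => ?_⟩
    have hmemE : ∀ {y : S} (hy : y ∈ E), IsIntegral E y := fun {y} hy =>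
      (isIntegral_algebraMap (R := E) (A := S) (x := ⟨y, hy⟩))
    have hX : ∀ i : Fin n, IsIntegral E (X i : S) := by
      intro i
      refine IsIntegral.of_pow two_pos (hmemE ((hE _).mpr ?_))
      have h := (isWeightedHomogeneous_X k w₂ i).pow 2
      have h4 : (2 : ℕ) • w₂ i = 0 := by
        rw [nsmul_eq_mul]; exact mul_eq_zero_of_left rfl _
      rwa [h4] at h
    induction x using MvPolynomial.induction_on with
    | C r => exact hmemE (Subalgebra.algebraMap_mem E r)
    | add p q hp hq => exact hp.add hq
    | mul_X p i hp => exact hp.mul (hX i)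
  have hinjE : Function.Injective (algebraMap (↥E) S) := fun x y h => Subtype.ext h
  have hM3 : (X '' ({a, b, d} : Set (Fin n)) : Set S) = {X a, X b, X d} := by
    simp only [Set.image_insert_eq, Set.image_singleton]
  haveI hM : (Ideal.span ({X a, X b, X d} : Set S)).IsPrime := by
    rw [← hM3, ← SpanX.ker_aeval_kill_eq_span_X ({a, b, d} : Set (Fin n))]
    exact RingHom.ker_isPrime _
  have hXa : (X a : S) ∈ Ideal.span ({X a, X b, X d} : Set S) := Ideal.subset_span (by simp)
  have hXb : (X b : S) ∈ Ideal.span ({X a, X b, X d} : Set S) := Ideal.subset_span (by simp)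
  have hXd : (X d : S) ∈ Ideal.span ({X a, X b, X d} : Set S) := Ideal.subset_span (by simp)
  refine ⟨ψC, ?_, ?_, ?_⟩
  · -- injective
    intro x y hxy
    have h1 : ψ' x = ψ' y := by rw [← hψC, ← hψC, hxy]
    have h2 := congrArg (fun z : ↥E => (z : S)) h1
    simp only [hψ'val] at h2
    exact hΦinj h2
  · -- range = fixed subring
    intro y
    constructor
    · rintro ⟨r, rfl⟩
      rw [hψC, hψ'val]
      exact (hΦmem r).2
    · intro hy
      have hmem : ((eE y : ↥E) : S) ∈ {f : S | IsWeightedHomogeneous w₂ f 0 ∧ σU f = f} :=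
        ⟨(hE _).mp (eE y).2, hy⟩
      rw [hfix] at hmem
      obtain ⟨Q, hQ, hQy⟩ := Subalgebra.mem_map.mp hmem
      obtain ⟨F, rfl⟩ := hQ
      refine ⟨Ideal.Quotient.mk _ F, ?_⟩
      apply eE.injective
      rw [hψC]
      exact Subtype.ext (by rw [hψ'val, hΦ, hlift_mk]; exact hQy)
  · -- the radical identity
    have hstep1 : (Ideal.span (base '' {X a, X b, X d} ∪ Set.range t)).comap ψC =
        (Ideal.span (eE '' (base '' {X a, X b, X d} ∪ Set.range t))).comap ψ' := by
      change (Ideal.span _).comap ((eE.symm : ↥E →+* C).comp ψ') = _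
      rw [← Ideal.comap_comap]
      congr 1
      change Ideal.comap eE.symm _ = _
      rw [Ideal.comap_symm, Ideal.map_span]
    have hrad : (Ideal.span (eE '' (base '' {X a, X b, X d} ∪ Set.range t))).radical =
        (Ideal.span ({X a, X b, X d} : Set S)).comap (algebraMap (↥E) S) := by
      refine JordanFour.radical_span_eq_comap_of_isIntegral hinjE _ _ ?_ ?_
      · rintro _ ⟨x, hx, rfl⟩
        rcases hx with ⟨F, hF, rfl⟩ | ⟨j, rfl⟩
        · change ((eE (base F) : ↥E) : S) ∈ _
          simp only [Set.mem_insert_iff, Set.mem_singleton_iff] at hF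
          rcases hF with rfl | rfl | rfl
          · rw [hbXa]; exact Ideal.pow_mem_of_mem _ hXa _ two_pos
          · rw [hbXb]; exact Ideal.mul_mem_left _ _ hXb
          · rw [hbXd]; exact Ideal.mul_mem_left _ _ hXd
        · change ((eE (t j) : ↥E) : S) ∈ _
          rcases hjcases j with rfl | rfl | rfl
          · rw [hval1]; exact Ideal.pow_mem_of_mem _ hXb _ two_pos
          · rw [hval2]; exact Ideal.mul_mem_left _ _ hXd
          · rw [hval3]; exact Ideal.pow_mem_of_mem _ hXd _ two_pos
      · have hgen : ∀ z : C, z ∈ base '' {X a, X b, X d} ∪ Set.range t → ((eE z : ↥E) : S) ∈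
            (Ideal.span (eE '' (base '' {X a, X b, X d} ∪ Set.range t))).map (algebraMap (↥E) S) :=
          fun z hz => Ideal.mem_map_of_mem (algebraMap (↥E) S) (Ideal.subset_span ⟨z, hz, rfl⟩)
        rw [Ideal.span_le]
        intro x hx
        simp only [Set.mem_insert_iff, Set.mem_singleton_iff] at hx
        rcases hx with rfl | rfl | rfl
        · refine ⟨2, ?_⟩
          have h := hgen _ (Set.mem_union_left _ ⟨X a, by simp, rfl⟩)
          rwa [hbXa] at h
        · refine ⟨2, ?_⟩
          have h := hgen _ (Set.mem_union_right _ ⟨⟨1, by decide⟩, rfl⟩)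
          rwa [hval1] at h
        · refine ⟨2, ?_⟩
          have h := hgen _ (Set.mem_union_right _ ⟨⟨3, by decide⟩, rfl⟩)
          rwa [hval3] at h
    rw [hstep1, ← Ideal.comap_radical, hrad, Ideal.comap_comap]
    have hcomp : (algebraMap (↥E) S).comp ψ' = Φ := RingHom.ext fun y => rfl
    rw [hcomp]
    change Ideal.comap ((θ : S →+* S).comp lift) _ = _
    rw [← Ideal.comap_comap]
    have hθM : (Ideal.span ({X a, X b, X d} : Set S)).comap (θ : S →+* S) =
        Ideal.span ({X a, X b, X d} : Set S) := by
      rw [← hM3]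
      exact comap_slotSubst32_span_X k n a b c d e p hab hac hae hbc hbd hbe hcd hce hde hp3
    rw [hθM]
    exact Half111.comap_lift_span_X k n a b d hab hbd had

end Summit.ResolutionOfSingularities.ResolutionOfSingularities.Theorems.WildQuotientResolution.JordanThreeTwo

end
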